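import Summits.BirchSwinnertonDyer.BirchSwinnertonDyer.Theorems.ClassRecordThreeEulerHalvesAtThreeCartanTorusCubeCutPSChar
import HarnessLib

/-!
# Crux 23422 line `cartan` v8′, stub (F2a), PRINCIPAL-SERIES half of the torus-cube cut — file PS-4: the unipotent radical
# `U = {(1 y; 0 1)}` and the mirabolic group `P = D·U`: `Σ_P χ_W = 0`, hence `N_D ∘ N_U = 0` and **`N_U w_S = 0`** (`X^B = 0`)

Seat `bsd-stepL-cartan-f2a` g0 (explicit unit, pen g44 AUTOFILL #2 row (3′); `--supports stmt-BirchSwinnertonDyer-23422 --as helper`).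
No new definition: the unipotent elements enter through an abstract parametrisation `u : 𝔽_q → GL₂(𝔽_q)` with `u y = (1 y; 0 1)`
(hypothesis `hu`; such a `u` exists, `exists_unipotentParam`), the mirabolic elements as `diag(x,1)·u(y) = (x xy; 0 1)`.
* `unipotentParam_mul` (`u(y)u(y′) = u(y+y′)`), `diagGL_mul_unipotentParam_mul` (closure of `P`), `diagGL_conj_unipotentParam`
  (`diag(x,1) u(y) diag(x,1)⁻¹ = u(xy)`), hence `rho_diagGL_comp_normU` (`ρ(diag(x,1)) ∘ N_U = N_U ∘ ρ(diag(x,1))`);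
* `char_diagGL_mul_unipotentParam` (values of `χ_W` on `P`, `q ≡ 1 (mod 3)`), `sum_char_unipotent_fibre` (`Σ_y χ_W(diag(x,1)u(y)) = q·g(x)`,
  `g = 2` on cubes, `−1` otherwise), `sum_g_eq_zero` (`Σ_x g(x) = 0`, from `#cubes = (q−1)/3`), `sum_char_mirabolic_group` (`Σ_P χ_W = 0`);
* `normD_comp_normU_eq_zero` (`N_P = N_D ∘ N_U = 0` on the lattice) and **`normU_wS_eq_zero`** (`Σ_y ρ(u(y)) w_S = 0`: `N_U w_S` is
  `T_s`-fixed, so a multiple `m·w_S`, and `0 = N_D N_U w_S = (q−1)m·w_S`), packaged as **`exists_unipotent_sum_eq_zero`** = the hypothesis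
  `hU` of the reductions `ps*_of_line` (files PS-3/3b/3c): `∃ U, |U| = q ∧ Σ_{u∈U} ρ(u) w_S = 0`.
HONEST FRAMING: finite-group averaging on one lattice; S-K1′ is NOT proved, no summit statement, no route item and no registered stub is
proved; BSD is proved for no curve. [folklore; background cite: Bump1997, §4.1]
-/

namespace Summit.BirchSwinnertonDyer.BirchSwinnertonDyer.Theorems.CartanTorusCubeCut.PS

open Summit.BirchSwinnertonDyer.BirchSwinnertonDyer.Theorems.CartanDegree
open Summit.BirchSwinnertonDyer.BirchSwinnertonDyer.Theorems.CartanTorusCubeCut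

set_option linter.dupNamespace false
set_option autoImplicit false

/-! ### The unipotent parametrisation -/

section NoFact
variable {q : ℕ}

/-- there is a parametrisation `y ↦ (1 y; 0 1)` of the upper unipotent elements of `GL₂(𝔽_q)`. -/
theorem exists_unipotentParam : ∃ u : ZMod q → G q, ∀ y, ((u y : G q) : Mat q) = !![1, y; 0, 1] :=
  ⟨fun y => ⟨!![1, y; 0, 1], !![1, -y; 0, 1],
      by rw [Matrix.mul_fin_two, Matrix.one_fin_two]; simp,
      by rw [Matrix.mul_fin_two, Matrix.one_fin_two]; simp⟩,
    fun _ => rfl⟩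

variable (u : ZMod q → G q) (hu : ∀ y, ((u y : G q) : Mat q) = !![1, y; 0, 1])
include hu

/-- `u(y) u(y′) = u(y + y′)`. -/
theorem unipotentParam_mul (y y' : ZMod q) : u y * u y' = u (y + y') := by
  apply Units.ext
  rw [Units.val_mul, hu, hu, hu, Matrix.mul_fin_two]
  simp [add_comm]

end NoFact

section Param
variable {q : ℕ} [Fact q.Prime]
variable (u : ZMod q → G q) (hu : ∀ y, ((u y : G q) : Mat q) = !![1, y; 0, 1])
include hu

/-- the matrix of `diag(x,1)·u(y)` is `(x xy; 0 1)`. -/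
theorem diagGL_mul_unipotentParam_coe (x : (ZMod q)ˣ) (y : ZMod q) :
    ((diagGL ![x, 1] * u y : G q) : Mat q) = !![(x : ZMod q), (x : ZMod q) * y; 0, 1] := by
  rw [Units.val_mul, diagGL_coe', hu, Matrix.mul_fin_two]
  simp

/-- the mirabolic parametrisation `(x, y) ↦ diag(x,1)·u(y)` is injective. -/
theorem diagGL_mul_unipotentParam_injective :
    Function.Injective (fun p : (ZMod q)ˣ × ZMod q => diagGL ![p.1, 1] * u p.2) := by
  intro p p' h
  have h' : diagGL ![p.1, 1] * u p.2 = diagGL ![p'.1, 1] * u p'.2 := h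
  have h00 : ((diagGL ![p.1, 1] * u p.2 : G q) : Mat q) 0 0 = ((diagGL ![p'.1, 1] * u p'.2 : G q) : Mat q) 0 0 := by
    rw [h']
  have h01 : ((diagGL ![p.1, 1] * u p.2 : G q) : Mat q) 0 1 = ((diagGL ![p'.1, 1] * u p'.2 : G q) : Mat q) 0 1 := by
    rw [h']
  rw [diagGL_mul_unipotentParam_coe u hu, diagGL_mul_unipotentParam_coe u hu] at h00 h01
  simp only [Matrix.of_apply, Matrix.cons_val', Matrix.cons_val_zero, Matrix.cons_val_one,
    Matrix.cons_val_fin_one] at h00 h01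
  have h1 : p.1 = p'.1 := Units.ext h00
  refine Prod.ext h1 ?_
  rw [h1] at h01
  exact mul_left_cancel₀ p'.1.ne_zero h01

/-- `diag(x,1) · u(y) = u(xy) · diag(x,1)`. -/
theorem diagGL_mul_unipotentParam_eq (x : (ZMod q)ˣ) (y : ZMod q) :
    diagGL ![x, 1] * u y = u ((x : ZMod q) * y) * diagGL ![x, 1] := by
  apply Units.ext
  rw [diagGL_mul_unipotentParam_coe u hu, Units.val_mul, hu, diagGL_coe', Matrix.mul_fin_two]
  simp

/-- closure of the mirabolic group: `(diag(x,1)u(y))·(diag(x′,1)u(y′)) = diag(xx′,1)·u(x′⁻¹y + y′)`. -/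
theorem diagGL_mul_unipotentParam_mul (x x' : (ZMod q)ˣ) (y y' : ZMod q) :
    (diagGL ![x, 1] * u y) * (diagGL ![x', 1] * u y') =
      diagGL ![x * x', 1] * u (((x'⁻¹ : (ZMod q)ˣ) : ZMod q) * y + y') := by
  have key : u y * diagGL ![x', 1] = diagGL ![x', 1] * u (((x'⁻¹ : (ZMod q)ˣ) : ZMod q) * y) := by
    rw [diagGL_mul_unipotentParam_eq u hu x', ← mul_assoc, ← Units.val_mul, mul_inv_cancel, Units.val_one,
      one_mul]
  calc (diagGL ![x, 1] * u y) * (diagGL ![x', 1] * u y')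
      = diagGL ![x, 1] * (u y * diagGL ![x', 1]) * u y' := by simp only [mul_assoc]
    _ = diagGL ![x, 1] * (diagGL ![x', 1] * u (((x'⁻¹ : (ZMod q)ˣ) : ZMod q) * y)) * u y' := by rw [key]
    _ = (diagGL ![x, 1] * diagGL ![x', 1]) * (u (((x'⁻¹ : (ZMod q)ˣ) : ZMod q) * y) * u y') := by
        simp only [mul_assoc]
    _ = diagGL ![x * x', 1] * u (((x'⁻¹ : (ZMod q)ˣ) : ZMod q) * y + y') := by
        rw [diagGL_mirabolic_mul, unipotentParam_mul u hu]

variable (𝓛 : CartanTorusLattice q)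

/-- `ρ(diag(x,1)) ∘ N_U = N_U ∘ ρ(diag(x,1))` (conjugation by `diag(x,1)` permutes `U`, `y ↦ xy`). -/
theorem rho_diagGL_comp_normU (x : (ZMod q)ˣ) :
    𝓛.ρ (diagGL ![x, 1]) * (∑ y : ZMod q, 𝓛.ρ (u y)) = (∑ y : ZMod q, 𝓛.ρ (u y)) * 𝓛.ρ (diagGL ![x, 1]) := by
  rw [Finset.mul_sum, Finset.sum_mul]
  simp_rw [← map_mul, diagGL_mul_unipotentParam_eq u hu]
  simp_rw [map_mul]
  exact Fintype.sum_equiv (Equiv.mulLeft₀ (x : ZMod q) x.ne_zero) _ _ (fun _ => rfl)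

/-- `N_U ∘ N_U = q·N_U`. -/
theorem normU_mul_self : (∑ y : ZMod q, 𝓛.ρ (u y)) * (∑ y : ZMod q, 𝓛.ρ (u y)) = (q : ℤ) • ∑ y : ZMod q, 𝓛.ρ (u y) := by
  rw [Finset.sum_mul]
  have : ∀ y : ZMod q, 𝓛.ρ (u y) * (∑ y' : ZMod q, 𝓛.ρ (u y')) = ∑ y' : ZMod q, 𝓛.ρ (u y') := by
    intro y
    rw [Finset.mul_sum]
    simp_rw [← map_mul, unipotentParam_mul u hu]
    exact Fintype.sum_equiv (Equiv.addLeft y) _ _ (fun _ => rfl)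
  rw [Finset.sum_congr rfl (fun y _ => this y), Finset.sum_const, Finset.card_univ, ZMod.card,
    Nat.cast_smul_eq_nsmul]

/-! ### Character values and sums on the mirabolic group (`q ≡ 1 (mod 3)`) -/

/-- `χ_W(diag(x,1)·u(y))`: `q+1` at the identity, `1` on non-trivial unipotents, `2`/`−1` for `x ≠ 1` a cube / non-cube. -/
theorem char_diagGL_mul_unipotentParam (h1 : q % 3 = 1) (x : (ZMod q)ˣ) (y : ZMod q) :
    cubicNewvectorChar q (diagGL ![x, 1] * u y) =
      if x = 1 then (if y = 0 then (q : ℤ) + 1 else 1)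
      else (if (x : ZMod q) ^ ((q - 1) / 3) = 1 then 2 else -1) := by
  rw [cubicNewvectorChar, diagGL_mul_unipotentParam_coe u hu]
  by_cases hx : x = 1
  · subst hx
    rw [if_pos rfl]
    by_cases hy : y = 0
    · subst hy
      rw [if_pos rfl, charMat_of_isScalar (by refine ⟨?_, ?_, ?_⟩ <;> simp), if_pos h1]
    · rw [if_neg hy]
      have : (!![((1 : (ZMod q)ˣ) : ZMod q), ((1 : (ZMod q)ˣ) : ZMod q) * y; 0, 1] : Mat q) = !![1, y; 0, 1] := by
        simp
      rw [this, charMat_unipotent h1 1 hy]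
  · rw [if_neg hx]
    have hx' : (x : ZMod q) ≠ 1 := fun h => hx (Units.ext h)
    rw [charMat_upper hx', charMat_diagonal h1 hx', one_pow]

/-- the fibre sums: `Σ_y χ_W(diag(x,1) u(y)) = q · g(x)` with `g(x) = 2` if `x` is a cube, `−1` otherwise (also at `x = 1`). -/
theorem sum_char_unipotent_fibre (h1 : q % 3 = 1) (x : (ZMod q)ˣ) :
    ∑ y : ZMod q, cubicNewvectorChar q (diagGL ![x, 1] * u y) =
      (q : ℤ) * (if (x : ZMod q) ^ ((q - 1) / 3) = 1 then 2 else -1) := by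
  classical
  simp_rw [char_diagGL_mul_unipotentParam u hu h1]
  by_cases hx : x = 1
  · subst hx
    simp only [if_true, Units.val_one, one_pow]
    rw [Finset.sum_ite, Finset.sum_const, Finset.sum_const, Finset.filter_eq', if_pos (Finset.mem_univ _),
      Finset.card_singleton, Finset.filter_ne', Finset.card_erase_of_mem (Finset.mem_univ _), Finset.card_univ,
      ZMod.card]
    have hq : 1 ≤ q := (Fact.out : q.Prime).one_le
    simp only [one_smul, nsmul_eq_mul, mul_one, Nat.cast_sub hq, Nat.cast_one]
    ring
  · simp only [hx, if_false, Finset.sum_const, Finset.card_univ, ZMod.card, nsmul_eq_mul]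

omit hu in
/-- `Σ_x g(x) = 0`: `2·#cubes − #non-cubes = 2k − 2k = 0` with `k = (q−1)/3 = #cubes`. -/
theorem sum_g_eq_zero (h1 : q % 3 = 1) :
    ∑ x : (ZMod q)ˣ, (if (x : ZMod q) ^ ((q - 1) / 3) = 1 then (2 : ℤ) else -1) = 0 := by
  classical
  have hq : q.Prime := Fact.out
  have e : ∀ x : (ZMod q)ˣ, (if (x : ZMod q) ^ ((q - 1) / 3) = 1 then (2 : ℤ) else -1) =
      3 * (if (x : ZMod q) ^ ((q - 1) / 3) = 1 then 1 else 0) - 1 := by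
    intro x; split_ifs <;> norm_num
  simp_rw [e]
  rw [Finset.sum_sub_distrib, ← Finset.mul_sum, Finset.sum_boole, Finset.sum_const, Finset.card_univ,
    ZMod.card_units, card_cubeRoots h1]
  simp only [nsmul_eq_mul, mul_one]
  have h3k := three_mul_k h1
  have : (3 : ℤ) * (((q - 1) / 3 : ℕ) : ℤ) = ((q - 1 : ℕ) : ℤ) := by exact_mod_cast h3k
  rw [this, sub_self]

/-- **`Σ_{P} χ_W = 0`** over the mirabolic group `P = {diag(x,1)u(y)}` (`q ≡ 1 (mod 3)`): `W^P = W^B = 0`. -/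
theorem sum_char_mirabolic_group (h1 : q % 3 = 1) :
    ∑ p : (ZMod q)ˣ × ZMod q, cubicNewvectorChar q (diagGL ![p.1, 1] * u p.2) = 0 := by
  rw [Fintype.sum_prod_type]
  simp_rw [sum_char_unipotent_fibre u hu h1]
  rw [← Finset.mul_sum, sum_g_eq_zero h1, mul_zero]

/-! ### `N_P = N_D ∘ N_U = 0` and `N_U w_S = 0` -/

/-- **`N_D ∘ N_U = 0`** on the lattice (`q ≡ 1 (mod 3)`): the mirabolic group has character sum `0`. -/
theorem normD_comp_normU_eq_zero (h1 : q % 3 = 1) :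
    (∑ x : (ZMod q)ˣ, 𝓛.ρ (diagGL ![x, 1])) * (∑ y : ZMod q, 𝓛.ρ (u y)) = 0 := by
  classical
  -- the mirabolic group as a finset
  set P : Finset (G q) := Finset.univ.image (fun p : (ZMod q)ˣ × ZMod q => diagGL ![p.1, 1] * u p.2) with hP
  have hinj := diagGL_mul_unipotentParam_injective u hu
  have hNP : normOp 𝓛 P = (∑ x : (ZMod q)ˣ, 𝓛.ρ (diagGL ![x, 1])) * (∑ y : ZMod q, 𝓛.ρ (u y)) := by
    rw [normOp, hP, Finset.sum_image (fun p _ p' _ h => hinj h), Fintype.sum_prod_type, Finset.sum_mul]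
    refine Finset.sum_congr rfl fun x _ => ?_
    rw [Finset.mul_sum]
    refine Finset.sum_congr rfl fun y _ => ?_
    rw [map_mul]
  rw [← hNP]
  refine normOp_eq_zero_of_sum_char_eq_zero 𝓛 (fun g hg g' hg' => ?_) ⟨diagGL ![1, 1] * u 0, ?_⟩ ?_
  · rw [hP, Finset.mem_image] at hg hg' ⊢
    obtain ⟨p, -, rfl⟩ := hg
    obtain ⟨p', -, rfl⟩ := hg'
    exact ⟨(p.1 * p'.1, ((p'.1⁻¹ : (ZMod q)ˣ) : ZMod q) * p.2 + p'.2), Finset.mem_univ _,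
      (diagGL_mul_unipotentParam_mul u hu p.1 p'.1 p.2 p'.2).symm⟩
  · rw [hP, Finset.mem_image]; exact ⟨(1, 0), Finset.mem_univ _, rfl⟩
  · rw [hP, Finset.sum_image (fun p _ p' _ h => hinj h)]
    exact sum_char_mirabolic_group u hu h1

/-- `u(y)` acting on a `T_s`-fixed… no: **`N_U w_S` is `T_s`-fixed** (`D` by the conjugation identity, `Z` by LEMMA Z). -/
theorem isSplitFixed_normU_wS {wS : Fin 𝓛.d → ℤ} (hS : 𝓛.IsSplitFixed wS) :
    𝓛.IsSplitFixed ((∑ y : ZMod q, 𝓛.ρ (u y)) wS) := by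
  intro g hg01 hg10
  have hg : g ∈ splitTorus q := by simp [splitTorus, hg01, hg10]
  rw [splitTorus_eq_image] at hg
  simp only [Finset.mem_image, Finset.mem_univ, true_and] at hg
  obtain ⟨v, rfl⟩ := hg
  rw [rho_diagGL 𝓛 v, ← Module.End.mul_apply, rho_diagGL_comp_normU u hu 𝓛, Module.End.mul_apply]
  congr 1
  apply hS
  · rw [diagGL_coe]; exact Matrix.diagonal_apply_ne _ (by decide)
  · rw [diagGL_coe]; exact Matrix.diagonal_apply_ne _ (by decide)

/-- **`N_U w_S = 0`** (`q ≡ 1 (mod 3)`): `N_U w_S = m·w_S` is `T_s`-fixed and `0 = N_D N_U w_S = (q−1)m·w_S`. -/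
theorem normU_wS_eq_zero (h1 : q % 3 = 1) {wS : Fin 𝓛.d → ℤ} (hS : 𝓛.IsSplitFixed wS)
    (hSgen : ∀ v, 𝓛.IsSplitFixed v → ∃ m : ℤ, v = m • wS) :
    (∑ y : ZMod q, 𝓛.ρ (u y)) wS = 0 := by
  have hq : q.Prime := Fact.out
  have hwS : wS ≠ 0 := wS_ne_zero 𝓛 h1 hSgen
  obtain ⟨m, hm⟩ := hSgen _ (isSplitFixed_normU_wS u hu 𝓛 hS)
  have h0 := congrArg (fun f => f wS) (normD_comp_normU_eq_zero u hu 𝓛 h1)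
  simp only [Module.End.mul_apply, LinearMap.zero_apply] at h0
  rw [hm, map_zsmul, LinearMap.sum_apply] at h0
  have hD : ∑ x : (ZMod q)ˣ, 𝓛.ρ (diagGL ![x, 1]) wS = ((q - 1 : ℕ) : ℤ) • wS := by
    have : ∀ x : (ZMod q)ˣ, 𝓛.ρ (diagGL ![x, 1]) wS = wS := fun x =>
      hS _ (by rw [diagGL_coe]; exact Matrix.diagonal_apply_ne _ (by decide))
        (by rw [diagGL_coe]; exact Matrix.diagonal_apply_ne _ (by decide))
    rw [Finset.sum_congr rfl (fun x _ => this x), Finset.sum_const, Finset.card_univ, ZMod.card_units,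
      Nat.cast_smul_eq_nsmul]
  rw [hD, smul_smul] at h0
  have hq1 : ((q - 1 : ℕ) : ℤ) ≠ 0 := by have := hq.two_le; exact_mod_cast (by omega : q - 1 ≠ 0)
  rcases smul_eq_zero.1 h0 with h | h
  · rcases mul_eq_zero.1 h with h' | h'
    · rw [h', zero_smul] at hm; exact hm
    · exact absurd h' hq1
  · exact absurd h hwS

end Param

variable {q : ℕ} [Fact q.Prime] in
/-- **the hypothesis `hU` of `ps*_of_line`**: a `q`-element `U ⊂ GL₂(𝔽_q)` (the upper unipotents) with `Σ_{u ∈ U} ρ(u) w_S = 0`. -/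
theorem exists_unipotent_sum_eq_zero (𝓛 : CartanTorusLattice q) (h1 : q % 3 = 1) {wS : Fin 𝓛.d → ℤ}
    (hS : 𝓛.IsSplitFixed wS) (hSgen : ∀ v, 𝓛.IsSplitFixed v → ∃ m : ℤ, v = m • wS) :
    ∃ U : Finset (G q), U.card = q ∧ ∑ u ∈ U, 𝓛.ρ u wS = 0 := by
  classical
  obtain ⟨u, hu⟩ := exists_unipotentParam (q := q)
  have hinj : Function.Injective u := by
    intro y y' h
    have h01 : ((u y : G q) : Mat q) 0 1 = ((u y' : G q) : Mat q) 0 1 := by rw [h]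
    rw [hu, hu] at h01
    simpa using h01
  refine ⟨Finset.univ.image u, ?_, ?_⟩
  · rw [Finset.card_image_of_injective _ hinj, Finset.card_univ, ZMod.card]
  · rw [Finset.sum_image (fun y _ y' _ h => hinj h), ← LinearMap.sum_apply]
    exact normU_wS_eq_zero u hu 𝓛 h1 hS hSgen

end Summit.BirchSwinnertonDyer.BirchSwinnertonDyer.Theorems.CartanTorusCubeCut.PS
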